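import Literature.Barriers.RiemannHypothesis.TuranPartialSumsShiftMain
import Literature.Barriers.RiemannHypothesis.TuranPartialSumsCriterion
import HarnessLib

/-!
# Sections of `ζ` beyond `σ = 1`: the vertical-shift construction — from `‖B‖ < R` to a zero

Barrier catalogue `Literature/Barriers/RiemannHypothesis/`, companion of
`TuranPartialSumsShiftMain.lean` (the quantities `Bval N`, `Rval N` of the vertical-shift phases
`ω(p) = p^{-iτ}`, `τ = (29/4)/log N`, on the primes `p ≤ √N`) and `TuranPartialSumsCriterion.lean`
(`exists_zero_of_criterion`: `‖B(1)‖ < ∑_p ‖c_p(1)‖` and `2‖c_p(1)‖ < ∑_q ‖c_q(1)‖` give a zero of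
`ζ_N` with `σ > 1`). Here the two are identified: with `S = {p ≤ √N prime}` and
`ω(p) = npow (iτ) p`, the smooth sum `B(1)` of the criterion IS `Bval N`, the big coefficients are
`c_p(1) = S(N/p)/p`, and the free primes are the primes in `(√N, N]`; hence
`‖Bval N‖ < Rval N` together with the side condition produces a zero of `ζ_N` beyond `σ = 1`
(`exists_zero_of_Bval_lt_Rval`).

## References

* [PlattTrudgian2016] D. J. Platt, T. S. Trudgian, *Zeroes of partial sums of the zeta-function*,
  LMS J. Comput. Math. 19 (2016), §2.2 (the criterion). The construction itself is the tree's.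
-/

noncomputable section

open Complex Finset

namespace Literature.Barriers.RiemannHypothesis

namespace TuranShift

variable {N : ℕ}

/-- The fixed phases of the construction: `ω(p) = p^{-iτ}`. [folklore] -/
def shiftPhase (N : ℕ) (p : ℕ) : ℂ := npow (tauN N * I) p

/-- The fixed set: the primes `p ≤ ⌊√N⌋`. [folklore] -/
def smallPrimes (N : ℕ) : Finset ℕ := (Finset.Icc 1 (Nat.sqrt N)).filter Nat.Prime

/-- Every prime with `p² ≤ N` is a small prime. [folklore] -/
theorem mem_smallPrimes_of_sq_le {p : ℕ} (hp : p.Prime) (hpp : p * p ≤ N) : p ∈ smallPrimes N := by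
  refine Finset.mem_filter.2 ⟨Finset.mem_Icc.2 ⟨hp.one_lt.le, Nat.le_sqrt.2 hpp⟩, hp⟩

/-- The phases are unimodular. [folklore] -/
theorem norm_shiftPhase {p : ℕ} (hp : 0 < p) : ‖shiftPhase N p‖ = 1 :=
  norm_npow_mul_I _ (by exact_mod_cast hp)

/-- `npow c` is completely multiplicative on the positive naturals: `complMul ω n = n^{-iτ}`.
[folklore] -/
theorem complMul_shiftPhase {n : ℕ} (hn : 0 < n) : complMul (shiftPhase N) n = npow (tauN N * I) n := by
  induction n using Nat.recOnPosPrimePosCoprime with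
  | prime_pow p k hp hk =>
    rw [complMul_prime_pow _ hp, shiftPhase]
    have hp0 : (0 : ℝ) < p := by exact_mod_cast hp.pos
    push_cast
    rw [npow, npow, ← Complex.exp_nat_mul, Real.log_pow]
    push_cast
    ring_nf
  | zero => omega
  | one => simp [npow]
  | coprime a b ha hb _ iha ihb =>
    rw [map_mul, iha (by omega), ihb (by omega)]
    push_cast
    rw [npow_mul _ (by exact_mod_cast (show 0 < a by omega)) (by exact_mod_cast (show 0 < b by omega))]

/-- The free primes of the criterion are the primes in `(√N, N]`. [folklore] -/
theorem freePrimes_eq_bigPrimes (N : ℕ) : freePrimes N (smallPrimes N) = bigPrimes N := by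
  ext p
  rw [mem_freePrimes, mem_bigPrimes]
  simp only [smallPrimes, Finset.mem_filter, Finset.mem_Icc, not_and]
  constructor
  · rintro ⟨⟨h1, h2⟩, hp, h3⟩
    refine ⟨⟨?_, h2⟩, hp⟩
    by_contra h
    exact h3 ⟨h1, not_lt.1 h⟩ hp
  · rintro ⟨⟨h1, h2⟩, hp⟩
    exact ⟨⟨hp.one_lt.le, h2⟩, hp, fun h ↦ absurd h.2 (not_le.2 h1)⟩

/-- The summands at `σ = 1`: `a_ω(k) k^{-1} = npow s k`. [folklore] -/
theorem complMul_mul_cpow_eq {k : ℕ} (hk : 0 < k) :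
    complMul (shiftPhase N) k * (k : ℂ) ^ (-(((1 : ℝ)) : ℂ)) = npow (sN N) k := by
  rw [complMul_shiftPhase hk, sN_def, npow_one_add _ (by exact_mod_cast hk)]
  push_cast
  rw [Complex.cpow_neg_one]

/-- The big coefficient at `σ = 1`: `c_p(1) = S(N/p)/p`. [folklore] -/
theorem bigCoeff_eq {p : ℕ} (hp : 0 < p) :
    bigCoeff N (shiftPhase N) p 1 = (((p : ℝ)⁻¹ : ℝ) : ℂ) * powSum (sN N) (N / p) := by
  unfold bigCoeff powSum
  rw [Finset.mul_sum]
  refine Finset.sum_congr rfl fun m hm ↦ ?_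
  have hm0 : 0 < m := (Finset.mem_Icc.1 hm).1
  rw [complMul_shiftPhase hm0, sN_def, npow_one_add _ (by exact_mod_cast hm0)]
  push_cast
  rw [Complex.cpow_neg_one]
  have hp' : (p : ℂ) ≠ 0 := by exact_mod_cast hp.ne'
  have hm' : (m : ℂ) ≠ 0 := by exact_mod_cast hm0.ne'
  field_simp

/-- `‖c_p(1)‖ = ‖S(N/p)‖/p`. [folklore] -/
theorem norm_bigCoeff_eq {p : ℕ} (hp : 0 < p) :
    ‖bigCoeff N (shiftPhase N) p 1‖ = ‖powSum (sN N) (N / p)‖ / p := by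
  rw [bigCoeff_eq hp, norm_mul, Complex.norm_real, Real.norm_eq_abs,
    abs_of_pos (inv_pos.2 (by exact_mod_cast hp))]
  ring

/-- `ω(p) c_p(1) = p^{-s} S(N/p)`. [folklore] -/
theorem shiftPhase_mul_bigCoeff {p : ℕ} (hp : 0 < p) :
    shiftPhase N p * bigCoeff N (shiftPhase N) p 1 = npow (sN N) p * powSum (sN N) (N / p) := by
  rw [bigCoeff_eq hp, shiftPhase, sN_def, npow_one_add _ (by exact_mod_cast hp)]
  ring

/-- **`Bval` is the smooth sum of the criterion** for `S = {p ≤ √N}`, `ω(p) = p^{-iτ}`. [folklore] -/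
theorem Bval_eq_smoothSum (N : ℕ) : Bval N = smoothSum N (smallPrimes N) (shiftPhase N) 1 := by
  have hSall : ∀ p : ℕ, p.Prime → p * p ≤ N → p ∈ smallPrimes N := fun p hp hpp ↦ mem_smallPrimes_of_sq_le hp hpp
  have hdec := twistedPartialSum_decomposition hSall (ω := shiftPhase N) (φ := shiftPhase N)
    (fun p _ ↦ rfl) (((1 : ℝ)) : ℂ) N le_rfl
  have hL : ∑ k ∈ Finset.Icc 1 N, complMul (shiftPhase N) k * (k : ℂ) ^ (-(((1 : ℝ)) : ℂ)) = powSum (sN N) N := by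
    unfold powSum
    exact Finset.sum_congr rfl fun k hk ↦ complMul_mul_cpow_eq (Finset.mem_Icc.1 hk).1
  have hF : ∑ r ∈ freePrimes N (smallPrimes N), shiftPhase N r *
      ∑ m ∈ Finset.Icc 1 (N / r), complMul (shiftPhase N) m * ((m * r : ℕ) : ℂ) ^ (-(((1 : ℝ)) : ℂ)) =
      ∑ p ∈ bigPrimes N, npow (sN N) p * powSum (sN N) (N / p) := by
    rw [freePrimes_eq_bigPrimes]
    refine Finset.sum_congr rfl fun p hp ↦ ?_
    have hp0 : 0 < p := (mem_bigPrimes.1 hp).2.pos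
    have := shiftPhase_mul_bigCoeff (N := N) hp0
    unfold bigCoeff at this
    exact this
  rw [hL, hF] at hdec
  unfold Bval smoothSum
  rw [hdec]
  ring

/-- **`Rval` is the sum of the moduli of the big coefficients.** [folklore] -/
theorem Rval_eq_sum_norm_bigCoeff (N : ℕ) :
    Rval N = ∑ p ∈ freePrimes N (smallPrimes N), ‖bigCoeff N (shiftPhase N) p 1‖ := by
  rw [freePrimes_eq_bigPrimes]
  unfold Rval
  refine Finset.sum_congr rfl fun p hp ↦ ?_
  rw [norm_bigCoeff_eq (mem_bigPrimes.1 hp).2.pos]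

/-- **From `‖B‖ < R` to a zero.** If `‖Bval N‖ < Rval N` and `2 ‖S(N/p)‖/p < Rval N` for every
prime `p ∈ (√N, N]`, then `ζ_N` has a zero with `σ > 1`. [cite: PlattTrudgian2016, §2.2] -/
theorem exists_zero_of_Bval_lt_Rval (h1 : ‖Bval N‖ < Rval N)
    (h2 : ∀ p ∈ bigPrimes N, 2 * (‖powSum (sN N) (N / p)‖ / p) < Rval N) :
    ∃ s : ℂ, 1 < s.re ∧ zetaPartialSum N s = 0 := by
  have hSall : ∀ p : ℕ, p.Prime → p * p ≤ N → p ∈ smallPrimes N := fun p hp hpp ↦ mem_smallPrimes_of_sq_le hp hpp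
  refine exists_zero_of_criterion hSall (ω := shiftPhase N) (fun p _ hp ↦ norm_shiftPhase hp.pos) ?_ ?_
  · rw [← Bval_eq_smoothSum, ← Rval_eq_sum_norm_bigCoeff]; exact h1
  · intro p hp
    rw [← Rval_eq_sum_norm_bigCoeff]
    rw [freePrimes_eq_bigPrimes] at hp
    rw [norm_bigCoeff_eq (mem_bigPrimes.1 hp).2.pos]
    exact h2 p hp

end TuranShift

end Literature.Barriers.RiemannHypothesis
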